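import Summits.QuantumFields.YangMills.Theorems.LangevinControlUVOSLegsAtWeakCouplingCDefs
import Summits.QuantumFields.YangMills.Theorems.LangevinControlUVOSLegsAtWeakCouplingCStubLocalityReduction
import Summits.QuantumFields.YangMills.Theorems.LangevinControlUVOSLegsFromFemtoAndGapStubUpgrade
import Summits.QuantumFields.YangMills.Theorems.MirrorModularBoostsCurvatureBoostCovarianceOrbitAllAngles
import Literature.MathematicalPhysics.QuantumFieldTheory.OSEuclideanRotationGenerator
import Mathlib.Analysis.Calculus.MeanValue
import HarnessLib

/-!
# Crux `OSLegsAtWeakCouplingC` (stmt-QuantumFields-16207), line `Sketch`: the rotation Ward identity integrates along the orbit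

Support file (lead c3) for the sharpening of the line's E1 import to its INFINITESIMAL form.  For a one-field family
`S₁` on `⁰𝒮((ℝ⁴)ⁿ)` with bounded densities off the diagonal (`OffDiagDensity`, landed `stub_density`) we show that the
**rotation Ward identity on the germ** — `S₁ n` annihilates the derivative `x ↦ DF(x)(Y x)` of every compactly
supported, separated, off-diagonal test function `F` of small diameter along the generator
`(Y x)_k = x_k⁰ e₁ − x_k¹ e₀` of the rotations of the `(x₀,x₁)`-plane — already forces `S₁ n` to be CONSTANT along the
orbit `θ ↦ R_θ · F` of every such `F` (`orbit_eq_of_ward`).  Mechanism (Osterwalder–Schrader I §4.2 run backwards, for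
a distribution instead of a density): the difference quotients `h⁻¹(R_h·F − F)` converge to the derivative `D` in
`L¹` (dominated convergence on the compact set swept out by the rotated supports, mean-value bound through the bounded
gradient of `F`), the density bound `‖S₁ n G‖ ≤ B ∫‖G‖` on separated compactly supported `G` turns this into
differentiability of the orbit function with derivative `S₁ n D = 0` at `θ = 0`, the group law `R_{θ+h} = R_h R_θ`
transports it to every `θ`, and a function with vanishing derivative is constant.  The sequel
(`…SketchGermWard`) removes the support conditions by density and the classification `SO(2)₀₁ = {planeRot 0 φ}`.

Tree vocabulary only (`planeRot`, `linActMulti`, `OffDiagDensity`, `Separated`, `SmallDiam`); no definitions.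
Refs: OsterwalderSchrader1973 §4.2 (4.15); GlimmJaffe1987 §6.1.
-/

set_option autoImplicit false

noncomputable section

open scoped SchwartzMap
open MeasureTheory Filter Topology Set Metric
open Literature.MathematicalPhysics.QuantumFieldTheory Literature.MathematicalPhysics.QuantumLattice
open Literature.MathematicalPhysics.AQFT
open Summit.QuantumFields.YangMills.Theorems.NPointIsotropy.Negative (E4)
open Summit.QuantumFields.YangMills.Theorems.OSLegsAtWeakCouplingC
  (integral_norm_linActMulti linActMulti_hasCompactSupport tsupport_linActMulti_subset_separated)
open Summit.QuantumFields.YangMills.Theorems.OSLegsFromFemtoAndGap.Upgrade (isOffDiagonal_linActMulti)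
open Summit.QuantumFields.YangMills.Theorems.CurvatureBoostCovariance.BoostsInheritMirrors.OrbitBandlimit
  (linActMulti_planeRot_add)

namespace Summit.QuantumFields.YangMills.Cruxes.OSLegsAtWeakCouplingC.Sketch

namespace GermWard

variable {n : ℕ}

/-! ## The generator of the plane rotations on configurations and on test functions -/

/-- The generator vector field `(Y x)_k = x_k⁰ e₁ − x_k¹ e₀` of the rotations of the `(x₀,x₁)`-plane acting
diagonally on configurations is (the map of) a continuous linear map. -/
theorem exists_rotField_clm :
    ∃ Y : (Fin n → E4) →L[ℝ] (Fin n → E4), ∀ x, Y x = fun k =>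
      (x k 0) • (EuclideanSpace.single 1 1 : E4) - (x k 1) • (EuclideanSpace.single 0 1 : E4) := by
  refine ⟨ContinuousLinearMap.pi fun k =>
      ((EuclideanSpace.proj (0 : Fin 4)).comp (ContinuousLinearMap.proj k)).smulRight
          (EuclideanSpace.single 1 1 : E4) -
        ((EuclideanSpace.proj (1 : Fin 4)).comp (ContinuousLinearMap.proj k)).smulRight
          (EuclideanSpace.single 0 1 : E4), fun x => ?_⟩
  funext k
  rfl

/-- The generator field is bounded by twice the configuration norm. -/
theorem norm_rotField_le (x : Fin n → E4) :
    ‖(fun k => (x k 0) • (EuclideanSpace.single 1 1 : E4) - (x k 1) • (EuclideanSpace.single 0 1 : E4))‖ ≤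
      2 * ‖x‖ := by
  refine (pi_norm_le_iff_of_nonneg (by positivity)).2 fun k => ?_
  calc ‖(x k 0) • (EuclideanSpace.single 1 1 : E4) - (x k 1) • (EuclideanSpace.single 0 1 : E4)‖
      ≤ ‖(x k 0) • (EuclideanSpace.single 1 1 : E4)‖ + ‖(x k 1) • (EuclideanSpace.single 0 1 : E4)‖ :=
        norm_sub_le _ _
    _ = |x k 0| + |x k 1| := by simp [norm_smul]
    _ ≤ ‖x k‖ + ‖x k‖ := add_le_add (by simpa using PiLp.norm_apply_le (x k) 0)
        (by simpa using PiLp.norm_apply_le (x k) 1)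
    _ ≤ ‖x‖ + ‖x‖ := add_le_add (norm_le_pi_norm x k) (norm_le_pi_norm x k)
    _ = 2 * ‖x‖ := by ring

/-- **The generator on test functions is a test function**: for every Schwartz `F` there is a Schwartz `D` with
`D x = DF(x)(Y x)` (the Fréchet derivative paired with the linear generator field, `bilinLeftCLM ∘ fderivCLM`). -/
theorem exists_schwartz_rotDeriv (F : 𝓢((Fin n → E4), ℂ)) :
    ∃ D : 𝓢((Fin n → E4), ℂ), ∀ x, D x = fderiv ℝ (F : (Fin n → E4) → ℂ) x
      (fun k => (x k 0) • (EuclideanSpace.single 1 1 : E4) - (x k 1) • (EuclideanSpace.single 0 1 : E4)) := by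
  obtain ⟨Y, hY⟩ := exists_rotField_clm (n := n)
  refine ⟨SchwartzMap.bilinLeftCLM (ContinuousLinearMap.id ℝ ((Fin n → E4) →L[ℝ] ℂ)) Y.hasTemperateGrowth
      (SchwartzMap.fderivCLM ℝ (Fin n → E4) ℂ F), fun x => ?_⟩
  rw [SchwartzMap.bilinLeftCLM_apply]
  simp [hY]

/-! ## Calculus along the orbit -/

/-- Pointwise, `R_θ · F` is `F` composed with the inverse rotation `R_{−θ}` in every argument. -/
theorem linActMulti_planeRot_apply (θ : ℝ) (F : 𝓢((Fin n → E4), ℂ)) (x : Fin n → E4) :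
    linActMulti (planeRot (0 : Fin 3) θ) F x = F (fun k => planeRot (0 : Fin 3) (-θ) (x k)) := by
  simp only [linActMulti_apply, planeRot_symm_apply]

/-- `R_0 · F = F`. -/
theorem linActMulti_planeRot_zero (F : 𝓢((Fin n → E4), ℂ)) : linActMulti (planeRot (0 : Fin 3) 0) F = F := by
  ext x
  rw [linActMulti_planeRot_apply, neg_zero]
  simp only [planeRot_zero_apply]

/-- The configuration rotated by `−s` has norm at most that of the configuration. -/
theorem norm_planeRot_cfg_le (s : ℝ) (x : Fin n → E4) : ‖(fun k => planeRot (0 : Fin 3) s (x k))‖ ≤ ‖x‖ :=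
  (pi_norm_le_iff_of_nonneg (norm_nonneg _)).2 fun k => by
    rw [LinearIsometryEquiv.norm_map]; exact norm_le_pi_norm x k

/-- **Derivative along the orbit**: `d/ds F(R_{−s} x) = DF(R_{−s}x)(Y(R_{−s}x))`. -/
theorem hasDerivAt_comp_planeRot_neg (F : 𝓢((Fin n → E4), ℂ)) (x : Fin n → E4) (s : ℝ) :
    HasDerivAt (fun s : ℝ => F (fun k => planeRot (0 : Fin 3) (-s) (x k)))
      (fderiv ℝ (F : (Fin n → E4) → ℂ) (fun k => planeRot (0 : Fin 3) (-s) (x k))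
        (fun k => (planeRot (0 : Fin 3) (-s) (x k) 0) • (EuclideanSpace.single 1 1 : E4) -
          (planeRot (0 : Fin 3) (-s) (x k) 1) • (EuclideanSpace.single 0 1 : E4))) s := by
  have h1 := hasDerivAt_planeRot_neg_diag (n := n) (0 : Fin 3) x s
  have h2 := (F.hasFDerivAt (fun k => planeRot (0 : Fin 3) (-s) (x k))).comp_hasDerivAt s h1
  refine h2.congr_deriv ?_
  congr 1
  funext k
  simp only [Fin.succ_zero_eq_one, neg_sub]
  rfl

/-- **Uniform bound on the orbit derivative**: `‖d/ds F(R_{−s}x)‖ ≤ 2 C ‖x‖` whenever `‖DF‖ ≤ C`. -/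
theorem norm_orbitDeriv_le (F : 𝓢((Fin n → E4), ℂ)) {C : ℝ} (hC : ∀ y, ‖fderiv ℝ (F : (Fin n → E4) → ℂ) y‖ ≤ C)
    (x : Fin n → E4) (s : ℝ) :
    ‖fderiv ℝ (F : (Fin n → E4) → ℂ) (fun k => planeRot (0 : Fin 3) (-s) (x k))
        (fun k => (planeRot (0 : Fin 3) (-s) (x k) 0) • (EuclideanSpace.single 1 1 : E4) -
          (planeRot (0 : Fin 3) (-s) (x k) 1) • (EuclideanSpace.single 0 1 : E4))‖ ≤ 2 * C * ‖x‖ := by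
  have hC0 : 0 ≤ C := (norm_nonneg _).trans (hC 0)
  refine (ContinuousLinearMap.le_opNorm _ _).trans ?_
  have h1 := hC (fun k => planeRot (0 : Fin 3) (-s) (x k))
  have h2 := (norm_rotField_le (fun k => planeRot (0 : Fin 3) (-s) (x k))).trans
    (mul_le_mul_of_nonneg_left (norm_planeRot_cfg_le (-s) x) (by norm_num))
  calc _ ≤ C * (2 * ‖x‖) := mul_le_mul h1 h2 (norm_nonneg _) hC0
    _ = 2 * C * ‖x‖ := by ring

/-- **Mean-value bound along the orbit**: `‖F(R_{−h}x) − F(x)‖ ≤ 2 C ‖x‖ |h|`. -/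
theorem norm_orbit_sub_le (F : 𝓢((Fin n → E4), ℂ)) {C : ℝ} (hC : ∀ y, ‖fderiv ℝ (F : (Fin n → E4) → ℂ) y‖ ≤ C)
    (x : Fin n → E4) (h : ℝ) :
    ‖F (fun k => planeRot (0 : Fin 3) (-h) (x k)) - F x‖ ≤ 2 * C * ‖x‖ * |h| := by
  have key := Convex.norm_image_sub_le_of_norm_hasDerivWithin_le (𝕜 := ℝ) (s := Set.univ)
    (f := fun s : ℝ => F (fun k => planeRot (0 : Fin 3) (-s) (x k)))
    (fun s _ => (hasDerivAt_comp_planeRot_neg F x s).hasDerivWithinAt)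
    (fun s _ => norm_orbitDeriv_le F hC x s) convex_univ (Set.mem_univ 0) (Set.mem_univ h)
  simp only [neg_zero, planeRot_zero_apply, sub_zero, Real.norm_eq_abs] at key
  exact key

/-! ## `L¹` convergence of the difference quotients -/

/-- **The difference quotients of the orbit converge to the generator derivative in `L¹`** (compactly supported
`F`): `∫ ‖h⁻¹(R_h·F − F) − D‖ → 0` as `h → 0`, `h ≠ 0`. -/
theorem tendsto_integral_norm_slope_sub (F D : 𝓢((Fin n → E4), ℂ))
    (hFc : HasCompactSupport (F : (Fin n → E4) → ℂ))
    (hD : ∀ x, D x = fderiv ℝ (F : (Fin n → E4) → ℂ) x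
      (fun k => (x k 0) • (EuclideanSpace.single 1 1 : E4) - (x k 1) • (EuclideanSpace.single 0 1 : E4))) :
    Tendsto (fun h : ℝ => ∫ x, ‖(h⁻¹ : ℂ) * (linActMulti (planeRot (0 : Fin 3) h) F x - F x) - D x‖)
      (𝓝[≠] 0) (𝓝 0) := by
  -- the rotated configurations and the compact set swept out by the rotated supports
  let ρ : ℝ → (Fin n → E4) → (Fin n → E4) := fun θ x k => planeRot (0 : Fin 3) θ (x k)
  have hρc : Continuous fun p : ℝ × (Fin n → E4) => ρ p.1 p.2 := continuous_planeRot_diag 0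
  have hρρ : ∀ θ x, ρ θ (ρ (-θ) x) = x := fun θ x => funext fun k => planeRot_apply_planeRot_neg 0 θ (x k)
  let K : Set (Fin n → E4) := (fun p : ℝ × (Fin n → E4) => ρ p.1 p.2) '' (closedBall (0 : ℝ) 1 ×ˢ tsupport (F : (Fin n → E4) → ℂ))
  have hKc : IsCompact K := ((isCompact_closedBall _ _).prod hFc.isCompact).image hρc
  have hmemK : ∀ θ : ℝ, |θ| ≤ 1 → ∀ x, ρ (-θ) x ∈ tsupport (F : (Fin n → E4) → ℂ) → x ∈ K := by
    intro θ hθ x hx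
    exact ⟨(θ, ρ (-θ) x), ⟨mem_closedBall_zero_iff.2 (by simpa [Real.norm_eq_abs] using hθ), hx⟩, hρρ θ x⟩
  have hFK : tsupport (F : (Fin n → E4) → ℂ) ⊆ K := fun x hx => by
    have h := hmemK 0 (by norm_num) x
    rw [neg_zero] at h
    exact h (by simpa [ρ, planeRot_zero_apply] using hx)
  -- bounds
  obtain ⟨C, hC⟩ := (F.smooth 1).continuous_fderiv (by simp) |>.bounded_above_of_compact_support (hFc.fderiv ℝ)
  have hC0 : 0 ≤ C := (norm_nonneg _).trans (hC 0)
  let bound : (Fin n → E4) → ℝ := K.indicator fun x => 2 * C * ‖x‖ + ‖D x‖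
  have hbound_int : Integrable bound := by
    rw [integrable_indicator_iff hKc.measurableSet]
    exact ((continuous_const.mul continuous_norm).add D.continuous.norm).continuousOn.integrableOn_compact hKc
  -- the functions
  let G : ℝ → (Fin n → E4) → ℝ := fun h x => ‖(h⁻¹ : ℂ) * (linActMulti (planeRot (0 : Fin 3) h) F x - F x) - D x‖
  have hGdef : ∀ h x, G h x = ‖(h⁻¹ : ℂ) * (F (ρ (-h) x) - F x) - D x‖ := fun h x => by
    simp only [G, linActMulti_planeRot_apply, ρ]
  -- off `K` everything vanishes; on `K` the mean-value bound
  have hD0 : ∀ x, x ∉ tsupport (F : (Fin n → E4) → ℂ) → D x = 0 := fun x hx => by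
    rw [hD x, fderiv_of_notMem_tsupport ℝ hx]
    rfl
  have hGle : ∀ h : ℝ, |h| ≤ 1 → ∀ x, G h x ≤ bound x := by
    intro h hh x
    by_cases hxK : x ∈ K
    · rw [hGdef]
      simp only [bound, indicator_of_mem hxK]
      refine (norm_sub_le _ _).trans (add_le_add ?_ le_rfl)
      rw [norm_mul, norm_inv, Complex.norm_real, Real.norm_eq_abs]
      by_cases h0 : h = 0
      · subst h0; simp; positivity
      · have hh0 : 0 < |h| := abs_pos.2 h0
        rw [inv_mul_le_iff₀ hh0]
        calc ‖F (ρ (-h) x) - F x‖ ≤ 2 * C * ‖x‖ * |h| := norm_orbit_sub_le F hC x h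
          _ = |h| * (2 * C * ‖x‖) := by ring
    · have hx : x ∉ tsupport (F : (Fin n → E4) → ℂ) := fun hx => hxK (hFK hx)
      have hx' : ρ (-h) x ∉ tsupport (F : (Fin n → E4) → ℂ) := fun hx' => hxK (hmemK h hh x hx')
      rw [hGdef, image_eq_zero_of_notMem_tsupport hx, image_eq_zero_of_notMem_tsupport hx', hD0 x hx]
      simp only [bound, indicator_of_notMem hxK, sub_self, mul_zero, norm_zero, le_refl]
  -- pointwise convergence: the difference quotient tends to the derivative
  have hlim : ∀ x, Tendsto (fun h => G h x) (𝓝[≠] 0) (𝓝 0) := by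
    intro x
    have hder : HasDerivAt (fun s : ℝ => F (ρ (-s) x)) (D x) 0 := by
      have h := hasDerivAt_comp_planeRot_neg F x 0
      simp only [neg_zero, planeRot_zero_apply] at h
      rw [hD x]
      exact h
    rw [hasDerivAt_iff_tendsto_slope] at hder
    have h2 : Tendsto (fun h => slope (fun s : ℝ => F (ρ (-s) x)) 0 h - D x) (𝓝[≠] 0) (𝓝 0) := by
      simpa using hder.sub_const (D x)
    have h3 := h2.norm
    rw [norm_zero] at h3
    refine h3.congr' ?_
    filter_upwards [self_mem_nhdsWithin] with h hh
    rw [hGdef, slope_def_module]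
    simp only [sub_zero, neg_zero, ρ, planeRot_zero_apply, Complex.real_smul, Complex.ofReal_inv]
  -- dominated convergence
  have hmeas : ∀ h, AEStronglyMeasurable (G h) volume := fun h =>
    (((continuous_const.mul ((linActMulti (planeRot (0 : Fin 3) h) F).continuous.sub F.continuous)).sub
      D.continuous).norm).aestronglyMeasurable
  have hev : ∀ᶠ h : ℝ in 𝓝[≠] 0, ∀ᵐ x ∂volume, ‖G h x‖ ≤ bound x := by
    have hball : ∀ᶠ h : ℝ in 𝓝[≠] (0 : ℝ), |h| ≤ 1 := by
      refine mem_nhdsWithin_of_mem_nhds ?_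
      filter_upwards [Metric.closedBall_mem_nhds (0 : ℝ) one_pos] with h hh
      simpa [Real.dist_eq] using hh
    filter_upwards [hball] with h hh
    refine Eventually.of_forall fun x => ?_
    rw [Real.norm_eq_abs, abs_of_nonneg (norm_nonneg _)]
    exact hGle h hh x
  have key := tendsto_integral_filter_of_dominated_convergence bound (Eventually.of_forall hmeas) hev hbound_int
    (Eventually.of_forall hlim)
  simp only [integral_zero] at key
  exact key

/-! ## The orbit function of a density-bounded functional -/

/-- `linActMulti R` preserves the class of test functions supported in configurations of diameter `< r₀`. -/
theorem tsupport_linActMulti_subset_smallDiam (R : E4 ≃ₗᵢ[ℝ] E4) {F : 𝓢((Fin n → E4), ℂ)} {r₀ : ℝ}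
    (hF : tsupport (F : (Fin n → E4) → ℂ) ⊆ SmallDiam n r₀) :
    tsupport (linActMulti R F : (Fin n → E4) → ℂ) ⊆ SmallDiam n r₀ := by
  intro x hx
  have hcont : Continuous (fun (x : Fin n → E4) (i : Fin n) => R.symm (x i)) :=
    continuous_pi fun i => R.symm.continuous.comp (continuous_apply i)
  have hx' := hF (tsupport_comp_subset_preimage (F : (Fin n → E4) → ℂ) hcont hx)
  intro i j
  have h := hx' i j
  rwa [LinearIsometryEquiv.dist_map] at h

/-- **The orbit function is differentiable at `0`, with derivative `S₁ n D`**, for a functional with the density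
bound `‖S₁ n G‖ ≤ B ∫‖G‖` on compactly supported `δ`-separated `G` and a compactly supported `δ`-separated `F`
(`D` = the generator derivative of `F`): the remainders `h⁻¹(R_h·F − F) − D` are such `G`'s and go to `0` in `L¹`. -/
theorem hasDerivAt_orbit_zero (S₁ : SchwingerFamily E4) {δ B : ℝ}
    (hB : ∀ G : 𝓢((Fin n → E4), ℂ), HasCompactSupport (G : (Fin n → E4) → ℂ) →
      tsupport (G : (Fin n → E4) → ℂ) ⊆ Separated n δ → ‖S₁ n G‖ ≤ B * ∫ x, ‖G x‖)
    (F D : 𝓢((Fin n → E4), ℂ)) (hFc : HasCompactSupport (F : (Fin n → E4) → ℂ))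
    (hFδ : tsupport (F : (Fin n → E4) → ℂ) ⊆ Separated n δ)
    (hD : ∀ x, D x = fderiv ℝ (F : (Fin n → E4) → ℂ) x
      (fun k => (x k 0) • (EuclideanSpace.single 1 1 : E4) - (x k 1) • (EuclideanSpace.single 0 1 : E4))) :
    HasDerivAt (fun θ : ℝ => S₁ n (linActMulti (planeRot (0 : Fin 3) θ) F)) (S₁ n D) 0 := by
  rw [hasDerivAt_iff_tendsto_slope]
  refine tendsto_iff_norm_sub_tendsto_zero.2 ?_
  -- the remainders as Schwartz maps
  let Gs : ℝ → 𝓢((Fin n → E4), ℂ) := fun h => (h⁻¹ : ℂ) • (linActMulti (planeRot (0 : Fin 3) h) F - F) - D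
  have hGs : ∀ h x, Gs h x = (h⁻¹ : ℂ) * (linActMulti (planeRot (0 : Fin 3) h) F x - F x) - D x :=
    fun h x => rfl
  have hslope : ∀ h : ℝ, slope (fun θ : ℝ => S₁ n (linActMulti (planeRot (0 : Fin 3) θ) F)) 0 h - S₁ n D =
      S₁ n (Gs h) := by
    intro h
    rw [slope_def_module, sub_zero, linActMulti_planeRot_zero]
    simp only [Gs, map_sub, map_smul, smul_eq_mul, Complex.real_smul, Complex.ofReal_inv]
  -- supports of the remainders
  have hD0 : ∀ x, x ∉ tsupport (F : (Fin n → E4) → ℂ) → D x = 0 := fun x hx => by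
    rw [hD x, fderiv_of_notMem_tsupport ℝ hx]
    rfl
  have hsuppG : ∀ h, tsupport (Gs h : (Fin n → E4) → ℂ) ⊆
      tsupport (linActMulti (planeRot (0 : Fin 3) h) F : (Fin n → E4) → ℂ) ∪ tsupport (F : (Fin n → E4) → ℂ) := by
    intro h
    refine closure_minimal (fun x hx => ?_) ((isClosed_tsupport _).union (isClosed_tsupport _))
    by_contra hx'
    simp only [Set.mem_union, not_or] at hx'
    apply hx
    show Gs h x = 0
    rw [hGs, image_eq_zero_of_notMem_tsupport hx'.1, image_eq_zero_of_notMem_tsupport hx'.2, hD0 x hx'.2]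
    simp
  have hGc : ∀ h, HasCompactSupport (Gs h : (Fin n → E4) → ℂ) := fun h =>
    IsCompact.of_isClosed_subset ((linActMulti_hasCompactSupport _ hFc).union hFc) (isClosed_tsupport _)
      (hsuppG h)
  have hGδ : ∀ h, tsupport (Gs h : (Fin n → E4) → ℂ) ⊆ Separated n δ := fun h =>
    (hsuppG h).trans (Set.union_subset (tsupport_linActMulti_subset_separated _ hFδ) hFδ)
  -- the density bound and the squeeze
  have hle : ∀ h : ℝ, ‖slope (fun θ : ℝ => S₁ n (linActMulti (planeRot (0 : Fin 3) θ) F)) 0 h - S₁ n D‖ ≤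
      max B 0 * ∫ x, ‖(h⁻¹ : ℂ) * (linActMulti (planeRot (0 : Fin 3) h) F x - F x) - D x‖ := by
    intro h
    rw [hslope]
    refine (hB (Gs h) (hGc h) (hGδ h)).trans ?_
    exact mul_le_mul_of_nonneg_right (le_max_left _ _) (integral_nonneg fun _ => norm_nonneg _)
  refine squeeze_zero (fun h => norm_nonneg _) hle ?_
  simpa using (tendsto_integral_norm_slope_sub F D hFc hD).const_mul (max B 0)

/-- **The rotation Ward identity on the germ makes the orbit function constant.**  If `S₁` has bounded densities
off the diagonal and annihilates the generator derivative of every compactly supported, separated, off-diagonal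
test function of diameter `< r₀`, then `S₁ n (R_θ · F) = S₁ n F` for every such `F` and every angle `θ`
(derivative zero at `0` for the rotated function `R_{θ₀}·F`, transported to `θ₀` by the group law; a function on
`ℝ` with vanishing derivative is constant). -/
theorem orbit_eq_of_ward (S₁ : SchwingerFamily E4) (hdens : OffDiagDensity S₁) {r₀ : ℝ}
    (hward : ∀ (F D : 𝓢((Fin n → E4), ℂ)), IsOffDiagonal F → HasCompactSupport (F : (Fin n → E4) → ℂ) →
      (∃ δ : ℝ, 0 < δ ∧ tsupport (F : (Fin n → E4) → ℂ) ⊆ Separated n δ) →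
      tsupport (F : (Fin n → E4) → ℂ) ⊆ SmallDiam n r₀ →
      (∀ x, D x = fderiv ℝ (F : (Fin n → E4) → ℂ) x
        (fun k => (x k 0) • (EuclideanSpace.single 1 1 : E4) - (x k 1) • (EuclideanSpace.single 0 1 : E4))) →
      S₁ n D = 0)
    (F : 𝓢((Fin n → E4), ℂ)) (hF : IsOffDiagonal F) (hFc : HasCompactSupport (F : (Fin n → E4) → ℂ)) {δ : ℝ}
    (hδ : 0 < δ) (hFδ : tsupport (F : (Fin n → E4) → ℂ) ⊆ Separated n δ)
    (hFr : tsupport (F : (Fin n → E4) → ℂ) ⊆ SmallDiam n r₀) (θ : ℝ) :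
    S₁ n (linActMulti (planeRot (0 : Fin 3) θ) F) = S₁ n F := by
  obtain ⟨B, hB⟩ := hdens n δ hδ
  set φ : ℝ → ℂ := fun θ => S₁ n (linActMulti (planeRot (0 : Fin 3) θ) F) with hφ
  -- vanishing derivative at every angle
  have hderiv : ∀ θ₀ : ℝ, HasDerivAt φ 0 θ₀ := by
    intro θ₀
    set F' : 𝓢((Fin n → E4), ℂ) := linActMulti (planeRot (0 : Fin 3) θ₀) F with hF'
    have hF'c : HasCompactSupport (F' : (Fin n → E4) → ℂ) := linActMulti_hasCompactSupport _ hFc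
    have hF'δ : tsupport (F' : (Fin n → E4) → ℂ) ⊆ Separated n δ := tsupport_linActMulti_subset_separated _ hFδ
    have hF'r : tsupport (F' : (Fin n → E4) → ℂ) ⊆ SmallDiam n r₀ := tsupport_linActMulti_subset_smallDiam _ hFr
    have hF'o : IsOffDiagonal F' := isOffDiagonal_linActMulti _ hF
    obtain ⟨D', hD'⟩ := exists_schwartz_rotDeriv F'
    have h0 : HasDerivAt (fun h : ℝ => S₁ n (linActMulti (planeRot (0 : Fin 3) h) F')) (S₁ n D') 0 :=
      hasDerivAt_orbit_zero S₁ hB F' D' hF'c hF'δ hD'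
    rw [hward F' D' hF'o hF'c ⟨δ, hδ, hF'δ⟩ hF'r hD'] at h0
    have heq : (fun h : ℝ => S₁ n (linActMulti (planeRot (0 : Fin 3) h) F')) = fun h => φ (θ₀ + h) := by
      funext h
      simp only [hφ, hF', linActMulti_planeRot_add]
    rw [heq] at h0
    have hinner : HasDerivAt (fun θ' : ℝ => θ' - θ₀) 1 θ₀ := (hasDerivAt_id' θ₀).sub_const θ₀
    have h0' : HasDerivAt (fun h : ℝ => φ (θ₀ + h)) (0 : ℂ) ((fun θ' : ℝ => θ' - θ₀) θ₀) := by
      simp only [sub_self]; exact h0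
    have h1 : HasDerivAt ((fun h : ℝ => φ (θ₀ + h)) ∘ (fun θ' : ℝ => θ' - θ₀)) ((1 : ℝ) • (0 : ℂ)) θ₀ :=
      HasDerivAt.scomp (𝕜 := ℝ) θ₀ h0' hinner
    rw [smul_zero] at h1
    refine h1.congr_of_eventuallyEq (Eventually.of_forall fun θ' => ?_)
    show φ θ' = φ (θ₀ + (θ' - θ₀))
    congr 1
    ring
  have hdiff : Differentiable ℝ φ := fun θ' => (hderiv θ').differentiableAt
  have hconst := is_const_of_deriv_eq_zero hdiff (fun θ' => (hderiv θ').deriv) θ 0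
  simpa [hφ, linActMulti_planeRot_zero] using hconst

end GermWard

end Summit.QuantumFields.YangMills.Cruxes.OSLegsAtWeakCouplingC.Sketch

end
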